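import Mathlib
import Summits.NavierStokesRegularity.NavierStokesRegularity.Theorems.FilamentSkeletonRssDefectColumnGateAzimuthalBlockTwoZoneLoopThree

/-!
# Route `FilamentSkeletonRss` · crux `TransverseReduction1AG` (stmt-NavierStokesRegularity-27853; A1L twin stmt-23297) · line
# `defect_column_gate_1AG/1AL` — smallness of the `N²`-feedback coefficient of the two-zone bound for large `Rc`

Helper file (`--supports stmt-NavierStokesRegularity-27853 --as helper`; seat ns-filament-s2aloc-p1 g2; note ARCHITECTURE-B2B3-s2aloc-g2.md v6 §8).
With `u₀ = (12/γ)log Rc` (`e^{γu₀/4} = Rc³`) the folded data size is `M_E = M + g·N`, `g = γ²Rc(1+u₀)²e^{−γu₀/4}/(8πm) = γ²(1+u₀)²/(8πmRc²)`, and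
the two-zone bound is `≤ K_c(1+u₀)¹¹Rc³M_E² ≤ 2K_c(1+u₀)¹¹Rc³(M² + g²N²)`.  `twoZone_absorb_small`: the `N²`-coefficient `2K_c(1+u₀)¹¹Rc³g²
= K_cγ⁴(1+u₀)¹⁵/(32π²m²Rc)` is `≤ 1/2` for `Rc ≥ R₁(γ, m, K_c)` (explicit: `max(1, (2B)⁴)`, `B = K_cγ⁴(1+768/γ)¹⁶/(32π²m²)`, via `log x ≤ 64·x^{1/64}`).
This is the last largeness condition of the packaged m-block bound (absorbing `N² ≤ sup(1+u)⁴(a²+b²)`).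
HONEST FRAMING: elementary real inequalities serving an a-priori bound for ONE family of blocks of ONE linear MODEL operator of a hypothetical
blow-up route (MODEL rung, negative side); `WaistColumnGateLoc1A`, `TransverseReduction1AG/1AL` are neither proved nor refuted; nothing here
bears on NS regularity.
-/

set_option linter.dupNamespace false

noncomputable section

namespace Summit.NavierStokesRegularity.NavierStokesRegularity.Theorems.DefectColumnGate

open Set

/-- `log x ≤ 64·x^{1/64}` (six square roots) for `x > 0`. -/
theorem log_le_sixtyfour_mul_sqrt_six {x : ℝ} (hx : 0 < x) :
    Real.log x ≤ 64 * Real.sqrt (Real.sqrt (Real.sqrt (Real.sqrt (Real.sqrt (Real.sqrt x))))) := by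
  have h1 : Real.log x = 64 * Real.log (Real.sqrt (Real.sqrt (Real.sqrt (Real.sqrt (Real.sqrt (Real.sqrt x)))))) := by
    rw [Real.log_sqrt (Real.sqrt_nonneg _), Real.log_sqrt (Real.sqrt_nonneg _), Real.log_sqrt (Real.sqrt_nonneg _),
      Real.log_sqrt (Real.sqrt_nonneg _), Real.log_sqrt (Real.sqrt_nonneg _), Real.log_sqrt hx.le]
    ring
  rw [h1]
  have h2 : 0 < Real.sqrt (Real.sqrt (Real.sqrt (Real.sqrt (Real.sqrt (Real.sqrt x))))) := by positivity
  have h3 := Real.log_le_sub_one_of_pos h2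
  linarith

/-- `(x^{1/64})¹⁶ = x^{1/4}` in square-root form. -/
theorem sqrt_six_pow_sixteen (x : ℝ) :
    Real.sqrt (Real.sqrt (Real.sqrt (Real.sqrt (Real.sqrt (Real.sqrt x))))) ^ 16 = Real.sqrt (Real.sqrt x) := by
  set q := Real.sqrt (Real.sqrt (Real.sqrt (Real.sqrt (Real.sqrt (Real.sqrt x))))) with hq
  have h1 : q ^ 16 = (((q ^ 2) ^ 2) ^ 2) ^ 2 := by ring
  rw [h1, hq, Real.sq_sqrt (Real.sqrt_nonneg _), Real.sq_sqrt (Real.sqrt_nonneg _), Real.sq_sqrt (Real.sqrt_nonneg _),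
    Real.sq_sqrt (Real.sqrt_nonneg _)]

set_option maxHeartbeats 1000000 in
/-- **The `N²`-feedback coefficient is small for large `Rc`.**  For `0 < γ`, `0 < m`, `0 ≤ K_c` there is `R₁ ≥ 1` such that for `Rc ≥ R₁`,
with `P = 1 + (12/γ)log Rc`: `2(K_cP¹¹Rc³)·(γ²Rc/(8πm)·P²e^{−γ((12/γ)log Rc)/4})² ≤ 1/2`. -/
theorem twoZone_absorb_small {γ m Kc : ℝ} (hγ : 0 < γ) (hm : 0 < m) (hKc : 0 ≤ Kc) :
    ∃ R₁ : ℝ, 1 ≤ R₁ ∧ ∀ Rc : ℝ, R₁ ≤ Rc →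
      2 * (Kc * (1 + 12 / γ * Real.log Rc) ^ 11 * Rc ^ 3)
        * (γ ^ 2 * Rc / (8 * Real.pi * m) * ((1 + 12 / γ * Real.log Rc) ^ 2 * Real.exp (-(γ * (12 / γ * Real.log Rc) / 4)))) ^ 2
        ≤ 1 / 2 := by
  have hπ : 0 < Real.pi := Real.pi_pos
  set B : ℝ := Kc * γ ^ 4 * (1 + 768 / γ) ^ 16 / (32 * Real.pi ^ 2 * m ^ 2) with hBdef
  have hB0 : 0 ≤ B := by positivity
  refine ⟨max 1 ((2 * B) ^ 4), le_max_left _ _, ?_⟩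
  intro Rc hRc
  have hRc1 : 1 ≤ Rc := le_trans (le_max_left _ _) hRc
  have hRc0 : 0 < Rc := by linarith
  have hRcB : (2 * B) ^ 4 ≤ Rc := le_trans (le_max_right _ _) hRc
  set L : ℝ := Real.log Rc with hLdef
  have hL0 : 0 ≤ L := Real.log_nonneg hRc1
  set P : ℝ := 1 + 12 / γ * L with hPdef
  have hP1 : 1 ≤ P := by
    rw [hPdef]
    have : 0 ≤ 12 / γ * L := by positivity
    linarith
  -- `e^{−γ u₀/4} = 1/Rc³`
  have hExp : Real.exp (-(γ * (12 / γ * L) / 4)) = 1 / Rc ^ 3 := by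
    have e : -(γ * (12 / γ * L) / 4) = -(L + L + L) := by field_simp; ring
    rw [e, Real.exp_neg, Real.exp_add, Real.exp_add, hLdef, Real.exp_log hRc0]
    field_simp
  have hKN : 2 * (Kc * P ^ 11 * Rc ^ 3) * (γ ^ 2 * Rc / (8 * Real.pi * m) * (P ^ 2 * (1 / Rc ^ 3))) ^ 2
      = Kc * γ ^ 4 * P ^ 15 / (32 * Real.pi ^ 2 * m ^ 2 * Rc) := by
    field_simp
    ring
  rw [hExp, hKN]
  -- `P¹⁵ ≤ (1 + 768/γ)¹⁶ · √√Rc`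
  set q : ℝ := Real.sqrt (Real.sqrt (Real.sqrt (Real.sqrt (Real.sqrt (Real.sqrt Rc))))) with hqdef
  have hsqrt1 : ∀ y : ℝ, 1 ≤ y → 1 ≤ Real.sqrt y := fun y hy => by rw [← Real.sqrt_one]; exact Real.sqrt_le_sqrt hy
  have hs1 : 1 ≤ Real.sqrt (Real.sqrt Rc) := hsqrt1 _ (hsqrt1 _ hRc1)
  have hq1 : 1 ≤ q := by
    rw [hqdef]; exact hsqrt1 _ (hsqrt1 _ (hsqrt1 _ (hsqrt1 _ (hsqrt1 _ (hsqrt1 _ hRc1)))))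
  have hLq : L ≤ 64 * q := by rw [hLdef, hqdef]; exact log_le_sixtyfour_mul_sqrt_six hRc0
  have hPq : P ≤ (1 + 768 / γ) * q := by
    rw [hPdef]
    have h1 : 12 / γ * L ≤ 12 / γ * (64 * q) := mul_le_mul_of_nonneg_left hLq (by positivity)
    have h2 : (1:ℝ) ≤ 1 * q := by linarith
    have e : (1 + 768 / γ) * q = 1 * q + 12 / γ * (64 * q) := by ring
    linarith [h1, h2, e]
  have hq16 : q ^ 16 = Real.sqrt (Real.sqrt Rc) := by rw [hqdef]; exact sqrt_six_pow_sixteen Rc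
  have hP16 : P ^ 16 ≤ (1 + 768 / γ) ^ 16 * Real.sqrt (Real.sqrt Rc) := by
    have h1 := pow_le_pow_left₀ (by linarith) hPq 16
    rw [mul_pow, hq16] at h1; exact h1
  have hP15 : P ^ 15 ≤ (1 + 768 / γ) ^ 16 * Real.sqrt (Real.sqrt Rc) :=
    (pow_le_pow_right₀ hP1 (by norm_num : 15 ≤ 16)).trans hP16
  -- `s := √√Rc`, `s⁴ = Rc`, `2B ≤ s`
  set s : ℝ := Real.sqrt (Real.sqrt Rc) with hsdef
  have hs4 : s ^ 4 = Rc := by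
    have e : s ^ 4 = (s ^ 2) ^ 2 := by ring
    rw [e, hsdef, Real.sq_sqrt (Real.sqrt_nonneg _), Real.sq_sqrt hRc0.le]
  have hsB : 2 * B ≤ s := by
    have h1 := Real.sqrt_le_sqrt (Real.sqrt_le_sqrt hRcB)
    have e1 : Real.sqrt (Real.sqrt ((2 * B) ^ 4)) = 2 * B := by
      have e2 : (2 * B) ^ 4 = ((2 * B) ^ 2) ^ 2 := by ring
      rw [e2, Real.sqrt_sq (by positivity), Real.sqrt_sq (by positivity)]
    rw [e1] at h1; exact h1
  -- conclusion
  have h1 : Kc * γ ^ 4 * P ^ 15 / (32 * Real.pi ^ 2 * m ^ 2 * Rc) ≤ Kc * γ ^ 4 * ((1 + 768 / γ) ^ 16 * s) / (32 * Real.pi ^ 2 * m ^ 2 * Rc) :=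
    div_le_div_of_nonneg_right (mul_le_mul_of_nonneg_left hP15 (by positivity)) (by positivity)
  have e : Kc * γ ^ 4 * ((1 + 768 / γ) ^ 16 * s) / (32 * Real.pi ^ 2 * m ^ 2 * Rc) = B * s / Rc := by
    rw [hBdef]; ring
  rw [e] at h1
  have h2 : B * s / Rc ≤ 1 / 2 := by
    rw [div_le_iff₀ hRc0, ← hs4]
    have h3 : B * s ≤ s / 2 * s := mul_le_mul_of_nonneg_right (by linarith [hsB]) (by positivity)
    have h4 : s ^ 2 ≤ s ^ 4 := pow_le_pow_right₀ hs1 (by norm_num)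
    nlinarith [h3, h4]
  exact h1.trans h2

end Summit.NavierStokesRegularity.NavierStokesRegularity.Theorems.DefectColumnGate

end
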